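import Literature.MathematicalPhysics.StatisticalMechanics.HardSphereContactTheoremProofs
import Literature.MathematicalPhysics.KineticTheory.HardSphereUniformGas
import HarnessLib

/-!
# The thin-shell pressure equation of the homogeneous hard-sphere local Gibbs law

Helper file (`--supports stmt-AtomisticToContinuum-9518`, line `conditional-covariance-liouville-rigidity`,
second lineage) landing the registered statics stub `stub_pressureEquation` of the crux
`CollisionalTransferLocality`: under the flow-invariant homogeneous local Gibbs law of `N + 1` hard spheres
of diameter `ε_N = σ (N+1)^{-1/3}` on `𝕋³` (activity `1`, drift `0`, temperature `θ`; reduced density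
`σ³ < η₀`), the expected number of ORDERED pairs per particle whose blown-up minimal-image distance lies in
the thin shell `(σ, σ(1+h)]`, divided by `h`, is within `e` of `6 (Z(σ³) − 1)` for `h < h₀` and
`N ≥ N₀` (`Z = hsCompressibility`, `Z(η) − 1 = η f_ex′(η)`).

This is a corollary of the tree's contact theorem `HardSphereContactTheorem_holds`
(`Literature/MathematicalPhysics/StatisticalMechanics/HardSphereContactTheoremProofs.lean`): the canonical
pair law at contact scale is `Y(σ³) ε³ vol(S)` up to a relative error `ζ`, uniformly on measurable subsets
`S` of thin shells, with `Y(η) = (3/2π) f_ex′(η)` (`contactValue`).  With `S` the shell itself,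
`vol(S) = (4π/3)((1+h)³ − 1)`, `(N+1) ε³ = σ³` and `(N+1) N` ordered pairs, the per-particle count is
`4π σ³ Y h (1 + O(h) + O(1/N)) = 6 (Z − 1) h (1 + o(1))` — the virial / contact ("pressure") equation
`βP/ρ = 1 + (2π/3) ρ d³ g(d⁺)` (Hansen–McDonald, *Theory of Simple Liquids*, 4th ed. 2013, §2.5).
The velocities are integrated out by the rung-0 product structure `integral_localGibbsLaw_rung0`.

Contents: the volume of the shell, the rescaling of the shell event, the reduction of the phase-space
integral to the configurational Gibbs measure, the evaluation of the double sum of indicators, an abstract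
averaging lemma, the final real-arithmetic estimate, and the stub.  No new definitions.
-/

namespace Summit.AtomisticToContinuum.HydrodynamicLimit.Theorems.ConditionalCovarianceLiouvilleRigidity

open MeasureTheory Set Filter
open scoped BigOperators ENNReal Pointwise
open Literature.MathematicalPhysics.KineticTheory Literature.MathematicalPhysics.StatisticalMechanics
  Literature.Analysis.FluidPDE

/-! ### Geometry of the thin shell -/

/-- The volume of the shell `{1 < ‖q‖ ≤ 1 + h}` in `ℝ³` is `(4π/3)((1+h)³ − 1) = 4π h (1 + h + h²/3)`.
[folklore] -/
theorem volume_shell_toReal {h : ℝ} (hh : 0 ≤ h) :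
    (volume {q : V3 | 1 < ‖q‖ ∧ ‖q‖ ≤ 1 + h}).toReal = 4 * Real.pi * h * (1 + h + h ^ 2 / 3) := by
  have hS : {q : V3 | 1 < ‖q‖ ∧ ‖q‖ ≤ 1 + h} =
      Metric.closedBall (0 : V3) (1 + h) \ Metric.closedBall 0 1 := by
    ext q
    simp only [mem_setOf_eq, Set.mem_sdiff, Metric.mem_closedBall, dist_zero_right, not_le]
    tauto
  rw [hS, ← measureReal_def,
    measureReal_sdiff (Metric.closedBall_subset_closedBall (by linarith)) Metric.isClosed_closedBall.measurableSet
      (measure_closedBall_lt_top).ne,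
    measureReal_def, measureReal_def, EuclideanSpace.volume_closedBall_fin_three,
    EuclideanSpace.volume_closedBall_fin_three, ENNReal.toReal_mul, ENNReal.toReal_mul,
    ← ENNReal.ofReal_pow (by linarith), ← ENNReal.ofReal_pow zero_le_one,
    ENNReal.toReal_ofReal (by positivity), ENNReal.toReal_ofReal (by positivity),
    ENNReal.toReal_ofReal (by positivity)]
  ring

/-- The shell is a measurable set. [folklore] -/
theorem measurableSet_shell (h : ℝ) : MeasurableSet {q : V3 | 1 < ‖q‖ ∧ ‖q‖ ≤ 1 + h} :=
  (measurableSet_lt measurable_const measurable_norm).inter (measurableSet_le measurable_norm measurable_const)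

/-- Rescaling of the shell event: for `ε c = σ`, `σ < c‖q‖ ≤ σ(1+h)` iff `q ∈ ε • {1 < ‖p‖ ≤ 1 + h}`.
[folklore] -/
theorem mem_smul_shell_iff {ε c σ h : ℝ} (hε : 0 < ε) (hc : 0 < c) (hεc : ε * c = σ) (q : V3) :
    (σ < c * ‖q‖ ∧ c * ‖q‖ ≤ σ * (1 + h)) ↔ q ∈ ε • {p : V3 | 1 < ‖p‖ ∧ ‖p‖ ≤ 1 + h} := by
  rw [Set.mem_smul_set_iff_inv_smul_mem₀ hε.ne', mem_setOf_eq, norm_smul, norm_inv, Real.norm_eq_abs,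
    abs_of_pos hε, ← div_eq_inv_mul, lt_div_iff₀ hε, div_le_iff₀ hε, one_mul, ← hεc]
  constructor
  · rintro ⟨h1, h2⟩
    exact ⟨by nlinarith, by nlinarith⟩
  · rintro ⟨h1, h2⟩
    exact ⟨by nlinarith, by nlinarith⟩

/-! ### Integration against the homogeneous local Gibbs law -/

/-- **Position observables under the homogeneous local Gibbs law**: for `σ ≤ 1/2`, `θ > 0`, an
observable of the positions only integrates, under `localGibbsLaw σ 1 0 θ N Φ`, to its integral under the
configurational Gibbs measure `posGibbsMeasure 1 ε_N (N+1)` (rung-0 product structure, the velocity factor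
being a probability measure). [folklore] -/
theorem integral_localGibbsLaw_one_pos {σ θ : ℝ} (hσ2 : σ ≤ 1 / 2) (hθ : 0 < θ) (N : ℕ)
    (Φ : HardSphereFlow (Torus.geometry (Fin 3)) (hsDiameter σ N) (N + 1))
    (F : (Fin (N + 1) → T3) → ℝ) :
    ∫ z, F (fun i => (z i).1) ∂(localGibbsLaw σ (fun _ => 1) (fun _ => 0) (fun _ => θ) N Φ) =
      ∫ x, F x ∂(posGibbsMeasure (fun _ : T3 => (1 : ℝ)) (hsDiameter σ N) (N + 1)) := by
  haveI := isProbabilityMeasure_posGibbsMeasure (a₀ := fun _ : T3 => (1 : ℝ)) continuous_const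
    (fun _ => one_pos) hσ2 N
  rw [integral_localGibbsLaw_rung0 σ zero_le_one hθ 0 N Φ (fun z => F (fun i => (z i).1))]
  have h := integral_fun_fst (μ := posGibbsMeasure (fun _ : T3 => (1 : ℝ)) (hsDiameter σ N) (N + 1))
    (ν := Measure.pi fun _ : Fin (N + 1) => gaussMeasure (0 : V3) θ) F
  rw [probReal_univ, one_smul] at h
  rw [← h]
  rfl

/-- **The double sum of shell indicators integrates to the double sum of pair probabilities** (finite
measure; the diagonal terms vanish). [folklore] -/
theorem integral_pairCount {N : ℕ} (μ : Measure (Fin (N + 1) → T3)) [IsFiniteMeasure μ] (σ c h : ℝ) :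
    ∫ x, ((N : ℝ) + 1)⁻¹ * ∑ i : Fin (N + 1), ∑ j : Fin (N + 1),
        (if j ≠ i ∧ σ < c * Torus.euclidDist (x i) (x j) ∧ c * Torus.euclidDist (x i) (x j) ≤ σ * (1 + h)
          then (1 : ℝ) else 0) ∂μ =
      ((N : ℝ) + 1)⁻¹ * ∑ i : Fin (N + 1), ∑ j : Fin (N + 1),
        if j ≠ i then μ.real {x | σ < c * Torus.euclidDist (x i) (x j) ∧
          c * Torus.euclidDist (x i) (x j) ≤ σ * (1 + h)} else 0 := by
  have hE : ∀ i j : Fin (N + 1), MeasurableSet {x : Fin (N + 1) → T3 | σ < c * Torus.euclidDist (x i) (x j) ∧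
      c * Torus.euclidDist (x i) (x j) ≤ σ * (1 + h)} := by
    intro i j
    have hg : Measurable fun x : Fin (N + 1) → T3 => c * Torus.euclidDist (x i) (x j) :=
      measurable_const.mul (continuous_euclidDist_apply i j).measurable
    exact (measurableSet_lt measurable_const hg).inter (measurableSet_le hg measurable_const)
  have hg : ∀ i j : Fin (N + 1), (fun x : Fin (N + 1) → T3 => if j ≠ i ∧ σ < c * Torus.euclidDist (x i) (x j) ∧
      c * Torus.euclidDist (x i) (x j) ≤ σ * (1 + h) then (1 : ℝ) else 0) =
      fun x => if j ≠ i then {x : Fin (N + 1) → T3 | σ < c * Torus.euclidDist (x i) (x j) ∧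
          c * Torus.euclidDist (x i) (x j) ≤ σ * (1 + h)}.indicator 1 x else 0 := by
    intro i j
    funext x
    by_cases hij : j ≠ i
    · by_cases hx : σ < c * Torus.euclidDist (x i) (x j) ∧ c * Torus.euclidDist (x i) (x j) ≤ σ * (1 + h)
      · rw [if_pos ⟨hij, hx⟩, if_pos hij, indicator_of_mem (by exact hx), Pi.one_apply]
      · rw [if_neg (fun h' => hx h'.2), if_pos hij, indicator_of_notMem (by exact hx)]
    · rw [if_neg (fun h' => hij h'.1), if_neg hij]
  have hint : ∀ i j : Fin (N + 1), Integrable (fun x : Fin (N + 1) → T3 =>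
      if j ≠ i ∧ σ < c * Torus.euclidDist (x i) (x j) ∧ c * Torus.euclidDist (x i) (x j) ≤ σ * (1 + h)
        then (1 : ℝ) else 0) μ := by
    intro i j
    rw [hg i j]
    by_cases hij : j ≠ i
    · simp only [if_pos hij]
      exact (integrable_const (1 : ℝ)).indicator (hE i j)
    · simp only [if_neg hij]
      exact integrable_const _
  rw [integral_const_mul]
  congr 1
  rw [integral_finsetSum _ fun i _ => integrable_finsetSum _ fun j _ => hint i j]
  refine Finset.sum_congr rfl fun i _ => ?_
  rw [integral_finsetSum _ fun j _ => hint i j]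
  refine Finset.sum_congr rfl fun j _ => ?_
  rw [hg i j]
  by_cases hij : j ≠ i
  · simp only [if_pos hij]
    exact integral_indicator_one (hE i j)
  · simp only [if_neg hij, integral_zero]

/-! ### Two elementary estimates -/

/-- **Averaging over ordered pairs**: if every off-diagonal `P i j` is within `E` of `T`, then
`(n+1)⁻¹ Σᵢ Σ_{j ≠ i} P i j` is within `(n+1) E` of `n T` (there are `(n+1) n` ordered pairs). [folklore] -/
theorem abs_avg_offDiag_sub_le {n : ℕ} (P : Fin (n + 1) → Fin (n + 1) → ℝ) {T E : ℝ} (hE : 0 ≤ E)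
    (hP : ∀ i j, j ≠ i → |P i j - T| ≤ E) :
    |((n : ℝ) + 1)⁻¹ * ∑ i, ∑ j, (if j ≠ i then P i j else 0) - n * T| ≤ ((n : ℝ) + 1) * E := by
  have hn : (0 : ℝ) < (n : ℝ) + 1 := by positivity
  have hrow : ∀ i : Fin (n + 1), ∑ j, (if j ≠ i then P i j else 0) =
      ∑ j, (if j ≠ i then P i j - T else 0) + n * T := by
    intro i
    have h1 : ∀ j : Fin (n + 1), (if j ≠ i then P i j else 0) =
        (if j ≠ i then P i j - T else 0) + (T - if j = i then T else 0) := by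
      intro j
      by_cases hji : j = i
      · simp [hji]
      · simp [hji]
    rw [Finset.sum_congr rfl fun j _ => h1 j, Finset.sum_add_distrib, Finset.sum_sub_distrib,
      Finset.sum_const, Finset.card_univ, Fintype.card_fin, Finset.sum_ite_eq' Finset.univ i (fun _ => T),
      if_pos (Finset.mem_univ _), nsmul_eq_mul]
    push_cast
    ring
  have hsum : ∑ i, ∑ j, (if j ≠ i then P i j else 0) =
      ∑ i, ∑ j, (if j ≠ i then P i j - T else 0) + ((n : ℝ) + 1) * (n * T) := by
    rw [Finset.sum_congr rfl fun i _ => hrow i, Finset.sum_add_distrib, Finset.sum_const, Finset.card_univ,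
      Fintype.card_fin, nsmul_eq_mul]
    push_cast
    ring
  have hbound : |∑ i, ∑ j, (if j ≠ i then P i j - T else 0)| ≤ ((n : ℝ) + 1) * (((n : ℝ) + 1) * E) := by
    calc |∑ i, ∑ j, (if j ≠ i then P i j - T else 0)|
        ≤ ∑ i, |∑ j, (if j ≠ i then P i j - T else 0)| := Finset.abs_sum_le_sum_abs _ _
      _ ≤ ∑ i, ∑ j, |(if j ≠ i then P i j - T else 0)| :=
          Finset.sum_le_sum fun i _ => Finset.abs_sum_le_sum_abs _ _
      _ ≤ ∑ _i : Fin (n + 1), ∑ _j : Fin (n + 1), E := by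
          refine Finset.sum_le_sum fun i _ => Finset.sum_le_sum fun j _ => ?_
          by_cases hji : j ≠ i
          · rw [if_pos hji]; exact hP i j hji
          · rw [if_neg hji, abs_zero]; exact hE
      _ = ((n : ℝ) + 1) * (((n : ℝ) + 1) * E) := by
          rw [Finset.sum_const, Finset.card_univ, Fintype.card_fin, nsmul_eq_mul, Finset.sum_const,
            Finset.card_univ, Fintype.card_fin, nsmul_eq_mul]
          push_cast
          ring
  rw [hsum, mul_add, ← mul_assoc _ ((n : ℝ) + 1), inv_mul_cancel₀ hn.ne', one_mul, add_sub_cancel_right,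
    abs_mul, abs_of_pos (inv_pos.2 hn)]
  calc ((n : ℝ) + 1)⁻¹ * |∑ i, ∑ j, (if j ≠ i then P i j - T else 0)|
      ≤ ((n : ℝ) + 1)⁻¹ * (((n : ℝ) + 1) * (((n : ℝ) + 1) * E)) :=
        mul_le_mul_of_nonneg_left hbound (inv_pos.2 hn).le
    _ = ((n : ℝ) + 1) * E := by field_simp

/-- **The final arithmetic**: with `s₃ = (n+1) e₃` (`= σ³`, `e₃ = ε³`), shell volume `4π h (1 + h + h²/3)`,
the per-particle thin-shell count `I` within `(n+1) ζ e₃ vol` of `n Y e₃ vol` (`ζ = e/(200 s₃)`), and the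
smallness conditions `200 s₃ (|Y|+1) h ≤ e`, `200 (|Y|+1) e₃ ≤ e`, `h ≤ 1`: `|I/h − 4π Y s₃| ≤ e`. [folklore] -/
theorem abs_thinShell_sub_le {I Y s3 e3 n h e : ℝ} (hn : 0 ≤ n) (he3 : 0 < e3) (hs : (n + 1) * e3 = s3)
    (hh : 0 < h) (hh1 : h ≤ 1) (he : 0 < e)
    (hhe : h * (200 * s3 * (|Y| + 1)) ≤ e) (he3e : e3 * (200 * (|Y| + 1)) ≤ e)
    (hI : |I - n * (Y * e3 * (4 * Real.pi * h * (1 + h + h ^ 2 / 3)))| ≤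
      (n + 1) * (e / (200 * s3) * e3 * (4 * Real.pi * h * (1 + h + h ^ 2 / 3)))) :
    |h⁻¹ * I - 4 * Real.pi * Y * s3| ≤ e := by
  subst hs
  set A : ℝ := 1 + h + h ^ 2 / 3 with hA
  have hA1 : 1 ≤ A := by rw [hA]; nlinarith
  have hA3 : A ≤ 3 := by rw [hA]; nlinarith
  have hAm : A - 1 ≤ 2 * h := by rw [hA]; nlinarith
  have hn1 : 0 < n + 1 := by linarith
  have hpi := Real.pi_pos
  have hpi4 := Real.pi_le_four
  have hY := abs_nonneg Y
  have hT1 : |h⁻¹ * (I - n * (Y * e3 * (4 * Real.pi * h * A)))| ≤ 48 * (e / 200) := by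
    rw [abs_mul, abs_of_pos (inv_pos.2 hh)]
    calc h⁻¹ * |I - n * (Y * e3 * (4 * Real.pi * h * A))|
        ≤ h⁻¹ * ((n + 1) * (e / (200 * ((n + 1) * e3)) * e3 * (4 * Real.pi * h * A))) :=
          mul_le_mul_of_nonneg_left hI (inv_pos.2 hh).le
      _ = 4 * Real.pi * A * (e / 200) := by field_simp
      _ ≤ 4 * 4 * 3 * (e / 200) := by gcongr
      _ = 48 * (e / 200) := by norm_num
  have hdec : h⁻¹ * I - 4 * Real.pi * Y * ((n + 1) * e3) =
      h⁻¹ * (I - n * (Y * e3 * (4 * Real.pi * h * A))) + 4 * Real.pi * Y * e3 * (n * (A - 1) - 1) := by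
    field_simp
    ring
  have hT2 : |4 * Real.pi * Y * e3 * (n * (A - 1) - 1)| ≤ 16 * |Y| * (2 * h * ((n + 1) * e3) + e3) := by
    rw [abs_mul, abs_mul, abs_mul, abs_mul, abs_of_pos hpi, abs_of_pos he3,
      abs_of_pos (by norm_num : (0 : ℝ) < 4)]
    have h1 : |n * (A - 1) - 1| ≤ n * (2 * h) + 1 := by
      refine (abs_sub _ _).trans ?_
      rw [abs_one, abs_of_nonneg (by nlinarith)]
      gcongr
    calc 4 * Real.pi * |Y| * e3 * |n * (A - 1) - 1| ≤ 4 * 4 * |Y| * e3 * (n * (2 * h) + 1) := by gcongr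
      _ = 16 * |Y| * (2 * h * (n * e3) + e3) := by ring
      _ ≤ 16 * |Y| * (2 * h * ((n + 1) * e3) + e3) := by gcongr; linarith
  rw [hdec]
  refine (abs_add_le _ _).trans ((add_le_add hT1 hT2).trans ?_)
  nlinarith [mul_nonneg (mul_nonneg hh.le (mul_nonneg hn1.le he3.le)) hY,
    mul_nonneg hh.le (mul_nonneg hn1.le he3.le), mul_nonneg he3.le hY]

/-- The target constant: `6 (Z(σ³) − 1) = 4π σ³ Y(σ³)` (`Z(η) − 1 = η f_ex′(η)`, `Y = (3/2π) f_ex′`). [folklore] -/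
theorem six_mul_hsCompressibility_sub_one (σ : ℝ) :
    6 * (hsCompressibility (σ ^ 3) - 1) = 4 * Real.pi * contactValue (σ ^ 3) * σ ^ 3 := by
  have hπ := Real.pi_pos.ne'
  simp only [hsCompressibility, contactValue]
  field_simp
  ring

/-! ### The stub -/

/-- **Thin-shell pressure equation for `hsCompressibility`** (registered stub `stub_pressureEquation` of
line `conditional-covariance-liouville-rigidity`, crux stmt-AtomisticToContinuum-9518).  There is `η₀ > 0`
such that for `σ³ < η₀`, under the flow-invariant homogeneous local Gibbs law (`a₀ ≡ 1`, `u₀ ≡ 0`,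
`θ₀ ≡ θ`) of `N + 1` hard spheres of diameter `σ (N+1)^{-1/3}` on `𝕋³`, the expected number of ORDERED
pairs at blown-up minimal-image distance in `(σ, σ(1+h)]` per particle, divided by `h`, is within `e` of
`6 (Z(σ³) − 1)` for `h < h₀(e)` and `N ≥ N₀(e, h)`.  Proof: the contact theorem
`HardSphereContactTheorem_holds` with `S` the shell `{1 < ‖q‖ ≤ 1 + h}` and relative error
`ζ = e/(200σ³)`; `η₀ = (min σ₁ ½)³`; the velocities integrate out (`integral_localGibbsLaw_rung0`);
`vol S = 4π h (1 + h + h²/3)`, `(N+1) ε³ = σ³`, and `4π σ³ Y(σ³) = 6 (Z(σ³) − 1)` (virial / contact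
equation, Hansen–McDonald 2013 §2.5). [folklore] -/
theorem stub_pressureEquation : ∃ η₀ : ℝ, 0 < η₀ ∧ ∀ σ : ℝ, 0 < σ → σ ^ 3 < η₀ → ∀ θ : ℝ, 0 < θ → ∀ e : ℝ, 0 < e → ∃ h₀ : ℝ, 0 < h₀ ∧ ∀ h : ℝ, 0 < h → h < h₀ → ∃ N₀ : ℕ, ∀ N : ℕ, N₀ ≤ N → ∀ Φ : Literature.Analysis.FluidPDE.HardSphereFlow (Literature.Analysis.FluidPDE.Torus.geometry (Fin 3)) (Literature.MathematicalPhysics.KineticTheory.hsDiameter σ N) (N + 1), |h⁻¹ * (∫ z, ((N : ℝ) + 1)⁻¹ * ∑ i : Fin (N + 1), ∑ j : Fin (N + 1), (if j ≠ i ∧ σ < (((N : ℝ) + 1) ^ ((1 : ℝ) / 3)) * Literature.Analysis.FluidPDE.Torus.euclidDist (z i).1 (z j).1 ∧ (((N : ℝ) + 1) ^ ((1 : ℝ) / 3)) * Literature.Analysis.FluidPDE.Torus.euclidDist (z i).1 (z j).1 ≤ σ * (1 + h) then (1 : ℝ) else 0) ∂(Literature.MathematicalPhysics.KineticTheory.localGibbsLaw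 σ (fun _ => 1) (fun _ => 0) (fun _ => θ) N Φ)) - 6 * (Literature.MathematicalPhysics.KineticTheory.hsCompressibility (σ ^ 3) - 1)| ≤ e := by
  obtain ⟨σ₁, hσ₁, hCT⟩ := HardSphereContactTheorem_holds
  have hm : 0 < min σ₁ (1 / 2) := lt_min hσ₁ (by norm_num)
  refine ⟨(min σ₁ (1 / 2)) ^ 3, pow_pos hm 3, fun σ hσ hσ3 θ hθ e he => ?_⟩
  have hσm : σ < min σ₁ (1 / 2) := lt_of_pow_lt_pow_left₀ 3 hm.le hσ3
  have hσ1 : σ < σ₁ := hσm.trans_le (min_le_left _ _)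
  have hσ2 : σ ≤ 1 / 2 := (hσm.trans_le (min_le_right _ _)).le
  have hs3 : 0 < σ ^ 3 := pow_pos hσ 3
  set Y : ℝ := contactValue (σ ^ 3) with hYdef
  have hY1 : 0 < |Y| + 1 := by positivity
  obtain ⟨δ₁, hδ₁, hδ⟩ := hCT σ hσ hσ1 (e / (200 * σ ^ 3)) (by positivity)
  refine ⟨min δ₁ (min 1 (e / (200 * σ ^ 3 * (|Y| + 1)))),
    lt_min hδ₁ (lt_min one_pos (by positivity)), fun h hh hh0 => ?_⟩
  have hhδ : h ≤ δ₁ := hh0.le.trans (min_le_left _ _)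
  have hh1 : h ≤ 1 := hh0.le.trans ((min_le_right _ _).trans (min_le_left _ _))
  have hhe : h ≤ e / (200 * σ ^ 3 * (|Y| + 1)) :=
    hh0.le.trans ((min_le_right _ _).trans (min_le_right _ _))
  have hhe' : h * (200 * σ ^ 3 * (|Y| + 1)) ≤ e := (le_div_iff₀ (by positivity)).1 hhe
  set S : Set V3 := {q | 1 < ‖q‖ ∧ ‖q‖ ≤ 1 + h} with hS
  have hSm : MeasurableSet S := by rw [hS]; exact measurableSet_shell h
  have hvol : (volume S).toReal = 4 * Real.pi * h * (1 + h + h ^ 2 / 3) := by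
    rw [hS]; exact volume_shell_toReal hh.le
  obtain ⟨N₁, hN₁⟩ := hδ h hh hhδ
  refine ⟨max N₁ ⌈200 * σ ^ 3 * (|Y| + 1) / e⌉₊, fun N hN Φ => ?_⟩
  have hNN₁ : N₁ ≤ N := le_of_max_le_left hN
  have hNe : 200 * σ ^ 3 * (|Y| + 1) / e ≤ N := Nat.ceil_le.1 (le_of_max_le_right hN)
  have hNpos : (0 : ℝ) < (N : ℝ) + 1 := by positivity
  have hε : 0 < hsDiameter σ N := hsDiameter_pos hσ N
  have hε3 : ((N : ℝ) + 1) * hsDiameter σ N ^ 3 = σ ^ 3 := by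
    have h3 := succ_mul_hsDiameter_pow_three σ N
    push_cast at h3
    exact h3
  have he3e : hsDiameter σ N ^ 3 * (200 * (|Y| + 1)) ≤ e := by
    refine le_of_mul_le_mul_left ?_ hNpos
    calc ((N : ℝ) + 1) * (hsDiameter σ N ^ 3 * (200 * (|Y| + 1))) = 200 * σ ^ 3 * (|Y| + 1) := by
          rw [← hε3]; ring
      _ ≤ (N : ℝ) * e := (div_le_iff₀ he).1 hNe
      _ ≤ ((N : ℝ) + 1) * e := by nlinarith
  haveI := isProbabilityMeasure_posGibbsMeasure (a₀ := fun _ : T3 => (1 : ℝ)) continuous_const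
    (fun _ => one_pos) hσ2 N
  set c : ℝ := ((N : ℝ) + 1) ^ ((1 : ℝ) / 3) with hc
  have hcpos : 0 < c := Real.rpow_pos_of_pos hNpos _
  have hεc : hsDiameter σ N * c = σ := by
    rw [hc, hsDiameter, Nat.cast_succ, Real.rpow_neg hNpos.le, mul_assoc, inv_mul_cancel₀ hcpos.ne', mul_one]
  -- the event
  have step2 : ∀ i j : Fin (N + 1),
      {x : Fin (N + 1) → T3 | σ < c * Torus.euclidDist (x i) (x j) ∧
          c * Torus.euclidDist (x i) (x j) ≤ σ * (1 + h)} =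
        {x | Torus.reprSym (x i - x j) ∈ hsDiameter σ N • S} := by
    intro i j
    ext x
    rw [mem_setOf_eq, mem_setOf_eq, Torus.euclidDist_eq, hS]
    exact mem_smul_shell_iff hε hcpos hεc _
  -- the integral
  have step1 : ∫ z, ((N : ℝ) + 1)⁻¹ * ∑ i : Fin (N + 1), ∑ j : Fin (N + 1),
      (if j ≠ i ∧ σ < c * Torus.euclidDist (z i).1 (z j).1 ∧ c * Torus.euclidDist (z i).1 (z j).1 ≤ σ * (1 + h)
        then (1 : ℝ) else 0) ∂(localGibbsLaw σ (fun _ => 1) (fun _ => 0) (fun _ => θ) N Φ) =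
      ((N : ℝ) + 1)⁻¹ * ∑ i : Fin (N + 1), ∑ j : Fin (N + 1),
        (if j ≠ i then (posGibbsMeasure (fun _ : T3 => (1 : ℝ)) (hsDiameter σ N) (N + 1)).real
          {x | Torus.reprSym (x i - x j) ∈ hsDiameter σ N • S} else 0) := by
    rw [integral_localGibbsLaw_one_pos hσ2 hθ N Φ (fun x => ((N : ℝ) + 1)⁻¹ * ∑ i : Fin (N + 1),
      ∑ j : Fin (N + 1), (if j ≠ i ∧ σ < c * Torus.euclidDist (x i) (x j) ∧
        c * Torus.euclidDist (x i) (x j) ≤ σ * (1 + h) then (1 : ℝ) else 0)),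
      integral_pairCount _ σ c h]
    simp only [step2]
  -- the contact theorem, pair by pair
  have step3 : ∀ i j : Fin (N + 1), j ≠ i →
      |(posGibbsMeasure (fun _ : T3 => (1 : ℝ)) (hsDiameter σ N) (N + 1)).real
          {x | Torus.reprSym (x i - x j) ∈ hsDiameter σ N • S} -
        Y * hsDiameter σ N ^ 3 * (volume S).toReal| ≤
        e / (200 * σ ^ 3) * hsDiameter σ N ^ 3 * (volume S).toReal :=
    fun i j hij => hN₁ N hNN₁ i j (Ne.symm hij) S hSm Subset.rfl
  have hE0 : 0 ≤ e / (200 * σ ^ 3) * hsDiameter σ N ^ 3 * (volume S).toReal := by positivity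
  have step4 := abs_avg_offDiag_sub_le
    (fun i j : Fin (N + 1) => (posGibbsMeasure (fun _ : T3 => (1 : ℝ)) (hsDiameter σ N) (N + 1)).real
      {x | Torus.reprSym (x i - x j) ∈ hsDiameter σ N • S}) hE0 step3
  rw [hvol] at step4
  rw [six_mul_hsCompressibility_sub_one, step1]
  exact abs_thinShell_sub_le (Nat.cast_nonneg N) (pow_pos hε 3) hε3 hh hh1 he hhe' he3e step4

end Summit.AtomisticToContinuum.HydrodynamicLimit.Theorems.ConditionalCovarianceLiouvilleRigidity
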